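import Summits.QuantumFields.YangMills.Theorems.FluctuationComparisonRegPrIntLS2BetaKPLExpansion

/-!
# KPL-C · the alternating-sign majorant of the truncated functional of a Kotecký–Preiss polymer gas

Cell `ym3-torus` (rung R3 = continuum SU(2) Yang–Mills on `T³`; NOT `d = 4`, NOT infinite volume, NOT a mass gap, NOT the
Clay problem), crux `stmt-QuantumFields-20520`, LINE g19-1 `Cruxes/FluctuationComparisonRegPrIntL/Lines/largefield_gas.lean` v2,
stub **KPL**: the one ingredient of KPL that was not in the tree.

**Theorem (`sign_majorant`).**  Let `ι` be a reflexive symmetric incompatibility on `P`, `L` a finite volume, `r ≥ 0` real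
activities obeying the finite-volume Kotecký–Preiss condition `Σ_{γ' ∈ L, γ' ι γ} r(γ') e^{a(γ')} ≤ a(γ)` (`IsKPVolume`).  Then for
every `C ⊆ L` the truncated functional `Φ^T` ([KP86] (3), the tree's `truncatedWeight`) satisfies

* `Re Φ^T(−r; C) ≤ 0` (and `Φ^T(−r; C)` is real), and
* `‖Φ^T(v; C)‖ ≤ −Re Φ^T(−r; C)` for every complex activity `v` with `‖v(γ)‖ ≤ r(γ)` on `L`

— the **alternating-sign property** of the Mayer/Ursell coefficients of a repulsive (hard-core) gas, [ScottSokal2005] Prop. 2.8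
(«`(−1)^{|n|−1} c_n(W) ≥ 0` for `0 ≤ W ≤ 1`», crediting Groeneveld 1962), in the set-resummed form the tree's `truncatedWeight` uses
(multiplicities are resummed inside the Möbius transform, so the sign statement becomes a MAJORANT statement: the common maximiser of
all `|Φ^T(·; C)|` on the polydisc `‖v‖ ≤ r` is the negative real corner `−r`).  It makes Kotecký–Preiss weight tables FIELD-UNIFORM:
for a family of activities `w_U` dominated by one KP majorant `w̄`, `‖Φ^T(w_U; C)‖ ≤ ‖Φ^T(−w̄; C)‖` for all `U` at once (sibling
`…S2BetaKPLogRep.lean`).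

**Proof (one-polymer deletion induction; no power series in several variables, no Penrose trees).**  Strong induction on `C`
(all radii `r` at once).  For `C = C' ∪ x`: `Φ^T(v; C) = Σ_{B ⊆ C'} (−1)^{|C'∖B|} (log Z(B ∪ x) − log Z(B))` and
`log Z(B ∪ x) − log Z(B) = Log(1 + u_B)`, `u_B = v(x)·Z(Bˣ)/Z(B) = v(x) exp(−Σ_{D ⊆ B, D ι x} Φ^T(D))` (KPL-A); expanding
`Log(1 + u) = Σ_{m ≥ 1} (−1)^{m+1} u^m/m` (Mathlib `Complex.hasSum_taylorSeries_log`) and extracting the families with support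
exactly `C'` (KPL-A `moebius_cexp_neg_sum_eq`) gives the convergent expansion (KPL-B `hasSum_expansion`)
`Φ^T(v; C) = Σ_{m ≥ 1} (−1)^{m+1} (v(x)^m/m) Σ_{𝒟 ⊆ {D ⊆ C' : D ι x}, ⋃𝒟 = C'} Π_{D ∈ 𝒟} (e^{−m Φ^T(D; v)} − 1)` in which every `D` is a PROPER subset of `C`.  At `v = −r` each term is real `≤ 0` (induction hypothesis: `Φ^T(D; −r) ≤ 0`, so
every factor `e^{−mΦ^T} − 1 ≥ 0`, and `(−1)^{m+1}(−r)^m = −r^m`); for `‖v‖ ≤ r` each term is dominated in norm by minus the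
`−r` term (`‖e^{z} − 1‖ ≤ e^{‖z‖} − 1` and the induction hypothesis `‖Φ^T(D; v)‖ ≤ −Φ^T(D; −r)`); `HasSum.norm_le_of_bounded`.
The smallness `‖u_B‖ < 1` along the whole ray `t·v`, `t ∈ [0,1]` (needed for the principal branch) is the induction hypothesis at
radius `t·r` plus POSITIVITY of `Z(B ∪ x; −t r) = Z(B; −tr) − t r(x) Z(Bˣ; −tr)` on the real KP segment (KPL-B `smallness_of_hyp`).

Everything is PROVED (0 sorry, no new definitions, no named facts).  HONEST: an abstract cluster-expansion lemma; nothing here is a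
claim about Bałaban's renormalisation group, `FluctuationComparisonRegPrIntL`, `LargeFieldPolymerRepCan`, or YM₃ on `T³`.

References: A. D. Scott, A. D. Sokal, J. Stat. Phys. 118 (2005) 1151–1261 (arXiv:cond-mat/0309352) Prop. 2.8 [ScottSokal2005];
R. Kotecký, D. Preiss, Comm. Math. Phys. 103 (1986) 491–498 [KoteckyPreiss1986]; S. Friedli, Y. Velenik, *Statistical Mechanics of
Lattice Systems* (2017) §5.4 [FriedliVelenik2017].
-/

noncomputable section

open Finset Filter Topology Set
open scoped BigOperators
open Literature.Probability.LatticeModels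
open Summit.QuantumFields.YangMills.Theorems.FluctuationComparisonRegPrIntLS2BetaKPLIncrement
open Summit.QuantumFields.YangMills.Theorems.FluctuationComparisonRegPrIntLS2BetaKPLExpansion

namespace Summit.QuantumFields.YangMills.Theorems.FluctuationComparisonRegPrIntLS2BetaKPLSignMajorant

variable {P : Type*} [DecidableEq P] {inc : P → P → Prop} [DecidableRel inc]

/-! ## §3 The alternating-sign majorant -/

section Majorant

variable [Std.Refl inc] [Std.Symm inc]

/-- **THE ALTERNATING-SIGN MAJORANT (all radii at once; the induction).**  For `r ≥ 0` KP-small on the finite volume `L` and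
`C ⊆ L`: `Re Φ^T(−r; C) ≤ 0`, and `‖Φ^T(v; C)‖ ≤ −Re Φ^T(−r; C)` whenever `‖v‖ ≤ r` on `L`.  Strong induction on `C`; see the file
header for the proof. [cite: ScottSokal2005, Prop. 2.8; KoteckyPreiss1986, Theorem p. 492] -/
theorem sign_majorant_aux (L C : Finset P) :
    ∀ (r a : P → ℝ), (∀ γ, 0 ≤ r γ) → IsKPVolume inc (fun γ => ((r γ : ℝ) : ℂ)) a L → C ⊆ L →
      (truncatedWeight inc (fun γ => ((-r γ : ℝ) : ℂ)) C).re ≤ 0 ∧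
      ∀ v : P → ℂ, (∀ γ ∈ L, ‖v γ‖ ≤ r γ) →
        ‖truncatedWeight inc v C‖ ≤ -(truncatedWeight inc (fun γ => ((-r γ : ℝ) : ℂ)) C).re := by
  induction C using Finset.strongInduction with
  | H C ih =>
  intro r a hr hKP hCL
  rcases C.eq_empty_or_nonempty with hCe | ⟨x, hxC⟩
  · subst hCe
    simp [Literature.Probability.LatticeModels.truncatedWeight_empty]
  -- `C = C' ∪ x`
  set C' : Finset P := C.erase x with hC'
  have hxC' : x ∉ C' := Finset.notMem_erase x C
  have hCeq : C = insert x C' := (Finset.insert_erase hxC).symm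
  have hC'C : C' ⊂ C := Finset.erase_ssubset hxC
  have hxL : x ∈ L := hCL hxC
  have hC'L : C' ⊆ L := (Finset.erase_subset x C).trans hCL
  have hCL' : insert x C' ⊆ L := hCeq ▸ hCL
  -- smallness along rays for every `‖v‖ ≤ r` (induction hypothesis at radius `t·r`)
  have hsmall : ∀ v : P → ℂ, (∀ γ ∈ L, ‖v γ‖ ≤ r γ) → ∀ B ⊆ C', ∀ t ∈ Set.Icc (0 : ℝ) 1,
      ‖(t : ℂ) * v x * (polymerPartitionFunction inc (fun γ => (t : ℂ) * v γ) (B.filter fun γ' => ¬ inc x γ') /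
        polymerPartitionFunction inc (fun γ => (t : ℂ) * v γ) B)‖ < 1 := by
    intro v hv B hB t ht
    have hBL : B ⊆ L := hB.trans hC'L
    have hxB : x ∉ B := fun h => hxC' (hB h)
    have hrt : ∀ γ, 0 ≤ t * r γ := fun γ => mul_nonneg ht.1 (hr γ)
    have hKPt : IsKPVolume inc (fun γ => (((t * r γ : ℝ)) : ℂ)) a L := isKPVolume_smul_radius hKP hr ht
    have hIHt : ∀ D ⊆ B, ∀ v' : P → ℂ, (∀ γ ∈ L, ‖v' γ‖ ≤ t * r γ) →
        ‖truncatedWeight inc v' D‖ ≤ -(truncatedWeight inc (fun γ => ((-(t * r γ) : ℝ) : ℂ)) D).re :=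
      fun D hD v' hv' => (ih D (Finset.ssubset_of_subset_of_ssubset (hD.trans hB) hC'C) (fun γ => t * r γ) a hrt hKPt
        (hD.trans hBL)).2 v' hv'
    have hvt : ∀ γ ∈ L, ‖(t : ℂ) * v γ‖ ≤ t * r γ := fun γ hγ => by
      rw [norm_mul, Complex.norm_real, Real.norm_eq_abs, abs_of_nonneg ht.1]
      exact mul_le_mul_of_nonneg_left (hv γ hγ) ht.1
    exact smallness_of_hyp hrt hKPt hxL hBL hxB hIHt hvt
  -- the two expansions
  set ρ : P → ℂ := fun γ => ((-r γ : ℝ) : ℂ) with hρ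
  have hρle : ∀ γ ∈ L, ‖ρ γ‖ ≤ r γ := norm_neg_ofReal_le hr L
  have hE : ∀ v : P → ℂ, (∀ γ ∈ L, ‖v γ‖ ≤ r γ) →
      HasSum (fun m : ℕ => (-1 : ℂ) ^ (m + 1) * v x ^ m / (m : ℂ) *
        ∑ 𝒟 ∈ (C'.powerset.filter fun D => KPTouches inc D x).powerset,
          (if 𝒟.biUnion id = C' then ∏ D ∈ 𝒟, (Complex.exp (-((m : ℂ) * truncatedWeight inc v D)) - 1) else 0))
      (truncatedWeight inc v (insert x C')) := fun v hv =>
    hasSum_expansion (isKPVolume_of_norm_le hKP hr hv) hCL' hxC' (hsmall v hv)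
  -- induction hypothesis at radius `r` on the sub-families of `C'`
  have hIH : ∀ D ⊆ C', (truncatedWeight inc ρ D).re ≤ 0 ∧ ∀ v : P → ℂ, (∀ γ ∈ L, ‖v γ‖ ≤ r γ) →
      ‖truncatedWeight inc v D‖ ≤ -(truncatedWeight inc ρ D).re := fun D hD =>
    ih D (Finset.ssubset_of_subset_of_ssubset hD hC'C) r a hr hKP (hD.trans hC'L)
  -- the real majorant of the `m`-th term
  set 𝒯 : Finset (Finset P) := C'.powerset.filter fun D => KPTouches inc D x with h𝒯
  set Mj : ℕ → ℝ := fun m => r x ^ m / (m : ℝ) * ∑ 𝒟 ∈ 𝒯.powerset,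
    (if 𝒟.biUnion id = C' then ∏ D ∈ 𝒟, (Real.exp (-((m : ℝ) * (truncatedWeight inc ρ D).re)) - 1) else 0) with hMj
  have hfac_nonneg : ∀ 𝒟 ∈ 𝒯.powerset, ∀ D ∈ 𝒟, ∀ m : ℕ,
      0 ≤ Real.exp (-((m : ℝ) * (truncatedWeight inc ρ D).re)) - 1 := by
    intro 𝒟 h𝒟 D hD m
    have hDC' : D ⊆ C' := subset_of_mem_of_mem_powerset_filter h𝒟 hD
    have h0 : 0 ≤ -((m : ℝ) * (truncatedWeight inc ρ D).re) := by
      have := (hIH D hDC').1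
      have hm : (0 : ℝ) ≤ m := Nat.cast_nonneg m
      nlinarith
    linarith [Real.add_one_le_exp (-((m : ℝ) * (truncatedWeight inc ρ D).re))]
  have hMj_nonneg : ∀ m, 0 ≤ Mj m := by
    intro m
    refine mul_nonneg (div_nonneg (pow_nonneg (hr x) m) (Nat.cast_nonneg m)) (Finset.sum_nonneg fun 𝒟 h𝒟 => ?_)
    split_ifs
    · exact Finset.prod_nonneg fun D hD => hfac_nonneg 𝒟 h𝒟 D hD m
    · exact le_rfl
  -- (a) the `−r` term IS `−Mj m`
  have hreal : ∀ D, truncatedWeight inc ρ D = (((truncatedWeight inc ρ D).re : ℝ) : ℂ) := fun D =>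
    (Complex.conj_eq_iff_re.1 (Complex.conj_eq_iff_im.2 (im_truncatedWeight_ofReal (fun γ => -r γ) D))).symm
  have hfacρ : ∀ D (m : ℕ), Complex.exp (-((m : ℂ) * truncatedWeight inc ρ D)) - 1 =
      (((Real.exp (-((m : ℝ) * (truncatedWeight inc ρ D).re)) - 1 : ℝ)) : ℂ) := by
    intro D m
    rw [hreal D]
    simp only [Complex.ofReal_re]
    push_cast
    rfl
  have htermρ : ∀ m : ℕ, (-1 : ℂ) ^ (m + 1) * ρ x ^ m / (m : ℂ) *
      ∑ 𝒟 ∈ 𝒯.powerset, (if 𝒟.biUnion id = C' then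
        ∏ D ∈ 𝒟, (Complex.exp (-((m : ℂ) * truncatedWeight inc ρ D)) - 1) else 0) = (((-Mj m : ℝ)) : ℂ) := by
    intro m
    have hsumρ : ∑ 𝒟 ∈ 𝒯.powerset, (if 𝒟.biUnion id = C' then
        ∏ D ∈ 𝒟, (Complex.exp (-((m : ℂ) * truncatedWeight inc ρ D)) - 1) else 0) =
        ((∑ 𝒟 ∈ 𝒯.powerset, (if 𝒟.biUnion id = C' then
          ∏ D ∈ 𝒟, (Real.exp (-((m : ℝ) * (truncatedWeight inc ρ D).re)) - 1) else 0) : ℝ) : ℂ) := by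
      rw [Complex.ofReal_sum]
      refine Finset.sum_congr rfl fun 𝒟 _ => ?_
      split_ifs
      · rw [Complex.ofReal_prod]
        exact Finset.prod_congr rfl fun D _ => hfacρ D m
      · simp
    have hcoef : (-1 : ℂ) ^ (m + 1) * ρ x ^ m = -(((r x ^ m : ℝ)) : ℂ) := by
      simp only [hρ]
      have hnp : (-((r x : ℝ) : ℂ)) ^ m = (-1) ^ m * ((r x : ℝ) : ℂ) ^ m := neg_pow _ m
      rw [Complex.ofReal_neg, hnp, ← mul_assoc, ← pow_add, Complex.ofReal_pow]
      have hodd : Odd (m + 1 + m) := ⟨m, by ring⟩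
      rw [hodd.neg_one_pow]
      ring
    rw [hsumρ, hcoef]
    simp only [hMj]
    push_cast
    ring
  -- (b) the `v` term is dominated by `Mj m`
  have htermv : ∀ v : P → ℂ, (∀ γ ∈ L, ‖v γ‖ ≤ r γ) → ∀ m : ℕ,
      ‖(-1 : ℂ) ^ (m + 1) * v x ^ m / (m : ℂ) *
        ∑ 𝒟 ∈ 𝒯.powerset, (if 𝒟.biUnion id = C' then
          ∏ D ∈ 𝒟, (Complex.exp (-((m : ℂ) * truncatedWeight inc v D)) - 1) else 0)‖ ≤ Mj m := by
    intro v hv m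
    have hE_le : ‖∑ 𝒟 ∈ 𝒯.powerset, (if 𝒟.biUnion id = C' then
        ∏ D ∈ 𝒟, (Complex.exp (-((m : ℂ) * truncatedWeight inc v D)) - 1) else 0)‖ ≤
        ∑ 𝒟 ∈ 𝒯.powerset, (if 𝒟.biUnion id = C' then
          ∏ D ∈ 𝒟, (Real.exp (-((m : ℝ) * (truncatedWeight inc ρ D).re)) - 1) else 0) := by
      refine (norm_sum_le _ _).trans (Finset.sum_le_sum fun 𝒟 h𝒟 => ?_)
      split_ifs
      · refine (Finset.norm_prod_le _ _).trans (Finset.prod_le_prod (fun D _ => norm_nonneg _) fun D hD => ?_)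
        have hDC' : D ⊆ C' := subset_of_mem_of_mem_powerset_filter h𝒟 hD
        have hIHD := (hIH D hDC').2 v hv
        calc ‖Complex.exp (-((m : ℂ) * truncatedWeight inc v D)) - 1‖
            ≤ Real.exp ‖-((m : ℂ) * truncatedWeight inc v D)‖ - 1 := norm_cexp_sub_one_le_exp_norm_sub_one _
          _ ≤ Real.exp (-((m : ℝ) * (truncatedWeight inc ρ D).re)) - 1 := by
              gcongr
              rw [norm_neg, norm_mul, Complex.norm_natCast, neg_mul_eq_mul_neg]
              exact mul_le_mul_of_nonneg_left hIHD (Nat.cast_nonneg m)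
      · simp
    have hvx : ‖v x‖ ^ m ≤ r x ^ m := pow_le_pow_left₀ (norm_nonneg _) (hv x hxL) m
    rw [norm_mul, norm_div, norm_mul, norm_pow, norm_pow, norm_neg, norm_one, one_pow, one_mul,
      Complex.norm_natCast]
    simp only [hMj]
    exact mul_le_mul (div_le_div_of_nonneg_right hvx (Nat.cast_nonneg m)) hE_le (norm_nonneg _)
      (div_nonneg (pow_nonneg (hr x) m) (Nat.cast_nonneg m))
  -- conclusion
  rw [hCeq]
  have hEρ_re : HasSum (fun m : ℕ => -Mj m) (truncatedWeight inc ρ (insert x C')).re := by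
    have h := Complex.hasSum_re (hE ρ hρle)
    convert h using 1
    funext m
    rw [htermρ m, Complex.ofReal_re]
  constructor
  · exact HasSum.nonpos (fun m => neg_nonpos.2 (hMj_nonneg m)) hEρ_re
  · intro v hv
    have hMj_sum : HasSum Mj (-(truncatedWeight inc ρ (insert x C')).re) := by
      have h := hEρ_re.neg
      simp only [neg_neg] at h
      exact h
    exact HasSum.norm_le_of_bounded (hE v hv) hMj_sum (htermv v hv)

/-- **THE ALTERNATING-SIGN MAJORANT.**  For a reflexive symmetric incompatibility, a finite volume `L`, real activities `r ≥ 0`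
obeying the finite-volume Kotecký–Preiss condition with size function `a`, and `C ⊆ L`:
(i) `Re Φ^T(−r; C) ≤ 0`; (ii) `‖Φ^T(v; C)‖ ≤ −Re Φ^T(−r; C)` for every complex activity with `‖v(γ)‖ ≤ r(γ)` on `L`.
[cite: ScottSokal2005, Prop. 2.8; KoteckyPreiss1986, Theorem p. 492] -/
theorem sign_majorant {r : P → ℝ} (hr : ∀ γ, 0 ≤ r γ) {a : P → ℝ} {L : Finset P}
    (hKP : IsKPVolume inc (fun γ => ((r γ : ℝ) : ℂ)) a L) {C : Finset P} (hC : C ⊆ L) :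
    (truncatedWeight inc (fun γ => ((-r γ : ℝ) : ℂ)) C).re ≤ 0 ∧
      ∀ v : P → ℂ, (∀ γ ∈ L, ‖v γ‖ ≤ r γ) →
        ‖truncatedWeight inc v C‖ ≤ -(truncatedWeight inc (fun γ => ((-r γ : ℝ) : ℂ)) C).re :=
  sign_majorant_aux L C r a hr hKP hC

omit [Std.Refl inc] [Std.Symm inc] in
/-- The truncated functional at the negative real corner is real. [cite: KoteckyPreiss1986, (3)] -/
theorem im_truncatedWeight_neg (r : P → ℝ) (C : Finset P) :
    (truncatedWeight inc (fun γ => ((-r γ : ℝ) : ℂ)) C).im = 0 :=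
  im_truncatedWeight_ofReal (fun γ => -r γ) C

/-- **FIELD-UNIFORM WEIGHTS (the form KPL consumes).**  Under the hypotheses of `sign_majorant`, every complex activity dominated
by `r` on `L` has `‖Φ^T(v; C)‖ ≤ ‖Φ^T(−r; C)‖` — one weight table for the whole polydisc. [cite: ScottSokal2005, Prop. 2.8] -/
theorem norm_truncatedWeight_le_norm_neg {r : P → ℝ} (hr : ∀ γ, 0 ≤ r γ) {a : P → ℝ} {L : Finset P}
    (hKP : IsKPVolume inc (fun γ => ((r γ : ℝ) : ℂ)) a L) {C : Finset P} (hC : C ⊆ L)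
    {v : P → ℂ} (hv : ∀ γ ∈ L, ‖v γ‖ ≤ r γ) :
    ‖truncatedWeight inc v C‖ ≤ ‖truncatedWeight inc (fun γ => ((-r γ : ℝ) : ℂ)) C‖ :=
  ((sign_majorant hr hKP hC).2 v hv).trans ((neg_le_abs _).trans (Complex.abs_re_le_norm _))

end Majorant

end Summit.QuantumFields.YangMills.Theorems.FluctuationComparisonRegPrIntLS2BetaKPLSignMajorant

end
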